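import Summits.BirchSwinnertonDyer.BirchSwinnertonDyer.Theorems.ManinLocalTwoThreeManinPrimeToAdditiveFiveLeDegreeUpThirteenOfOrdinaryTwistLaw
import Summits.BirchSwinnertonDyer.BirchSwinnertonDyer.Theorems.ManinLocalTwoThreeManinPrimeToAdditiveFiveLeBistarredKodaira
import Summits.BirchSwinnertonDyer.BirchSwinnertonDyer.Theorems.ManinLocalTwoThreeManinPrimeToAdditiveFiveLeRedFiveSevenCellsTwin
import Summits.BirchSwinnertonDyer.BirchSwinnertonDyer.Theorems.AdditiveBranchIMCGordTwoRankOneCM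
import HarnessLib

/-!
# Route `ManinLocalTwoThree`, residual crux C5 `ManinPrimeToAdditiveFiveLe`
# (stmt-BirchSwinnertonDyer-22969), line `upper_anchor` (skeleton v9, sha 15e8acc5ed72):
# **the last line-private law, DEGREE-UP(7; II), IS the cell's registered conjecture E-imc-9
# `OrdinaryRamifiedTwistLaw 7` — with the potential ordinarity of the cell discharged in kernel**

Width seat bsd-line-ml23-c5-p1-w4 (gen 0), piece ο (sequel of -w2's υ2, p626766, which identified
`stub_degreeUp13Red` with E-imc-9 at `13`). After the lead's gen-5 cell split (p625709, p626637) the v8 anchor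
`stub_red57unstarredOffIIAtFive` of the line reads, kernel-checked,
  ANCHOR ⟸ SS57 ∧ ORD7 ∧ CORNER(5; III) ∧ ANCHOR(7; IV*) ∧ DEGREE-UP(7; II),
where DEGREE-UP(7; II) (hypothesis `hUp` of ν p624458, verbatim in p626637) is the Manin-free degree law «for `W`
globally minimal, lattice-optimal at conductor level, `49 ∣ N(W) > 5·10⁵`, twist-minimal, `W[7]` reducible, no `Iₙ*`
fibre, `ord₇ Δ_min(W) = 2` (Kodaira II), `7 ∣ deg`, and EVERY lattice-optimal `W′` with `N(W′) = N(W)`,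
`W ⊗ (−7) ∼ W′`: `deg(D′) = 7·deg(D)`» — the `(7; II)` instance of gen 3's degree law. It was the LAST law
hypothesis private to the line (U = E-imc-5 by υ p626338; DEG13 = E-imc-9(13) by υ2 p626766).

THIS FILE shows DEGREE-UP(7; II) is a COROLLARY of E-imc-9 `OrdinaryRamifiedTwistLaw 7`
(`Summits/BirchSwinnertonDyer/Rank1Residual/ManinAdditive/OrdinaryRamifiedTwistLaw.lean`; REF1 SURVIVES
2026-08-27T16:22Z; the law as stated is NOT in print) and modularity — and, unlike at `13` where the stub CARRIES a
(G)-ordinary binder, here the potential good ORDINARY reduction demanded by E-imc-9 is PROVED from the cell's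
Kodaira datum by the tree's dictionary (cell `b2b-bsdres`, `Rank1Residual/Additive/*`):

* §1 `typeGOrd_seven_of_padicValInt_eq_two_or_four` — **at `7`, an additive fibre without `Iₙ*` of Kodaira type
  II or IV (`ord₇ Δ_min ∈ {2, 4}`, tame index `e ∈ {6, 3}`) is (G)-ORDINARY**: no `Iₙ*` ⟹ `ord₇ j ≥ 0`
  (`MemberManinUnitFiveSevenGlue.padicValRat_j_nonneg_of_forall_ne_Istar`); `12 ∣ 6·ord₇ Δ` ⟹ Delbourgo's (G)
  (`typeG_iff_padicValRat`); `3 ∤ ord₇ Δ_min` ⟹ `j ≡ 0`, ordinary at `7 ≡ 1 (mod 3)` by Deuring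
  (`typeGOrd_of_typeG_of_padicValRat_j`); then `HasPotentiallyGoodOrdinaryReductionAtPrime 7` by the landed
  `AdditiveBranchIMCGordTwoRankOne.hasPotentiallyGoodOrdinaryReductionAtPrime_of_typeGOrd` (route AdditiveBranchIMC).
  Companion `typeGOrd_five_of_padicValInt_eq_three` — **(5; III)
  (`e = 4`) is (G)-ordinary** (`12 ∣ 4·3`, `2 ∤ 3` ⟹ `j ≡ 1728`, ordinary at `5 ≡ 1 (mod 4)`). Together with
  -w2's starred rows (`typeGOrd_iff_eq_nine_of_starred_five`, `typeGOrd_iff_ne_nine_of_starred_seven`) and the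
  lead's `not_typeGOrd_of_red57ssCell`, this completes the in-tree (G)-ordinarity table of the additive fibres at
  `5` and `7` (the `l ∈ {5, 7}` rows of [DokchitserDokchitser2015LocalInvariants, Thm. 3.2]).
* §2 `degreeUp_of_ordinaryRamifiedTwistLaw` — **υ2's trichotomy/index-engine argument made uniform in `p ≥ 5`**:
  `OrdinaryRamifiedTwistLaw p`, modularity, `p² ∣ N(W)`, `W` potentially good ordinary at `p` with
  `ord_p Δ_min(W) < 6`, `D` lattice-optimal ⟹ every lattice-optimal `D′` of a globally minimal `W′ ∼ W ⊗ p*` with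
  `N(W′) = N(W)` has `deg(D′) = p·deg(D)` (cases (i) done, (ii) clause 2, (iii) flip killed by clause 1 + the
  an-cell's PROVED `optimal_orbit_index_engine` at `s = 1` over the common period lattice).
  Then `degreeUpIISeven_of_ordinaryRamifiedTwistLaw` — **DEGREE-UP(7; II) VERBATIM ⟸ `OrdinaryRamifiedTwistLaw 7`**
  (§1 ∘ §2; the twist-minimality, reducibility, `7 ∣ deg`, `N > 5·10⁵` binders are idle), and
  `degreeUp57Ord_of_ordinaryRamifiedTwistLaw` — the same law on ALL THREE potentially-ordinary unstarred cells
  `(5; III), (7; II), (7; IV)` ⟸ E-imc-9(5) ∧ E-imc-9(7) (census HOME data/TWISTCENSUS2: 377 + 112 + 43 commuting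
  orbits in range, all with `v_p(deg′) = v_p(deg) + 1`; the potentially supersingular cells FLIP and are excluded).
* §3 `coreRED57unstarredOffII5_of_cells_of_anchorIVstarSeven_of_ordinaryRamifiedTwistLaw` — **the v8 anchor
  ⟸ SS57 ∧ ORD7 ∧ CORNER(5; III) ∧ ANCHOR(7; IV*) ∧ `OrdinaryRamifiedTwistLaw 7`** (p626637 fed with §2).

NET EFFECT on the line's ledger (with υ p626338, υ2 p626766): NO law private to the line remains. The residual of
C5 along `upper_anchor` reads {four pure Manin cells SS57 (5;IV)∪(7;III), ORD7 (7;IV), CORNER (5;III),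
ANCHOR (7;IV*)} ∪ {E-imc-5(5) ∧ E-imc-5(7), E-imc-9(7) ∧ E-imc-9(13), KP57 (stmt-23810), the cite-only prints
incl. GK}. HONEST STATUS: conditional-result helper (`--supports … --as helper`); E-imc-9 is an OPEN conjecture of
the cell (not in print); nothing here proves BSD, Manin's conjecture, E-imc-9, the anchor stub or C5.

References: [DokchitserDokchitser2015LocalInvariants] Thm. 3.2 (Kodaira type vs. ordinarity at `l ≥ 5`), Thm. 7 /
Cor. 8; [Delbourgo1998] §1.5 (hypothesis (G)); [SilvermanAEC2009] V.4.1(a), Ex. V.4.4–4.5 (Deuring: `j = 0`,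
`1728`), VII.5.5; [SilvermanATAEC1994] IV Table 4.1; [Watkins2002] §2.1; [ZagierCMB1985] §1; [Stevens1989] (5.2),
(5.4); [DiamondShurman2005] §5.8, Thm. 8.8.3; [EdixhovenManin1991] Thm. 3, §4; cell bsd-f2-manin MEMO-imc.md §10.
-/

set_option autoImplicit false
-- the Theorems namespace of this sub repeats the summit name by design (D-0017 nested layout)
set_option linter.dupNamespace false

noncomputable section

open scoped Classical NumberField

namespace Summit.BirchSwinnertonDyer.BirchSwinnertonDyer.Theorems

open WeierstrassCurve IsDedekindDomain IsDedekindDomain.HeightOneSpectrum Rat.HeightOneSpectrum NumberField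
  Literature.NumberTheory.EllipticCurves Literature.NumberTheory.EllipticCurves.ModularForms
  Literature.NumberTheory.EllipticCurves.Rank1Residual
  Literature.NumberTheory.DiophantineGeometry
  Summit.BirchSwinnertonDyer.Rank1Residual.ManinAdditive
  Summit.BirchSwinnertonDyer.Rank1Residual.Additive
  Summit.BirchSwinnertonDyer.BirchSwinnertonDyer.Theses.EdixhovenFibreFiveSeven

/-! ## §1 Dictionary: the potentially-ordinary UNSTARRED additive fibres at `5` and `7` are (G)-ordinary -/

section Dictionary

variable (W : WeierstrassCurve ℚ) [W.IsElliptic] [W.IsGloballyMinimal] (p : ℕ) [hp : Fact p.Prime]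

/-- **No `Iₙ*` fibre at an odd additive prime ⟹ `ord_p j ≥ 0`**, with the hypothesis read at the single place
`placeOf p` (the stubs' `(primesEquiv (R := ℤ)).symm ⟨p, hp⟩`). [cite: SilvermanATAEC1994, IV Table 4.1] -/
theorem padicValRat_j_nonneg_of_forall_ne_Istar_placeOf (hp2 : p ≠ 2) (hadd : Addv W p)
    (hI : ∀ n : ℕ, W.kodairaSymbolAt (placeOf p) ≠ .Istar n) : 0 ≤ padicValRat p W.j := by
  refine MemberManinUnitFiveSevenGlue.padicValRat_j_nonneg_of_forall_ne_Istar W hp2 hadd ?_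
  intro v n hv' hK
  have hvv : v = placeOf p := (primesEquiv (R := ℤ)).injective
    (Subtype.ext (hv'.trans (natGenerator_placeOf_eq p).symm))
  subst hvv
  exact hI n hK

/-- **At `7`, an additive fibre without `Iₙ*` of Kodaira type II or IV (`ord₇ Δ_min ∈ {2, 4}`) is (G)-ORDINARY.**
`ord₇ j ≥ 0` (no `Iₙ*`); `12 ∣ (7 − 1)·ord₇ Δ` gives Delbourgo's (G) (`typeG_iff_padicValRat`); `3 ∤ ord₇ Δ_min`
gives `j ≡ 0 (mod 7)`, ordinary since `7 ≡ 1 (mod 3)` (`typeGOrd_of_typeG_of_padicValRat_j`). The unstarred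
`l = 7` rows of [DokchitserDokchitser2015LocalInvariants, Thm. 3.2]; census cells (7; II) (112 optimal
`W[7]`-reducible curves in range) and (7; IV) (43). [cite: DokchitserDokchitser2015LocalInvariants, Thm. 3.2]
[cite: SilvermanAEC2009, V.4.1(a) and Exercises V.4.4–4.5] -/
theorem typeGOrd_seven_of_padicValInt_eq_two_or_four (h7 : p = 7) (hadd : Addv W p)
    (hI : ∀ n : ℕ, W.kodairaSymbolAt (placeOf p) ≠ .Istar n)
    (hv : padicValInt p W.minimalDiscriminantInt = 2 ∨ padicValInt p W.minimalDiscriminantInt = 4) :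
    TypeGOrd W p := by
  have hp5 : 5 ≤ p := by omega
  have hj : 0 ≤ padicValRat p W.j := padicValRat_j_nonneg_of_forall_ne_Istar_placeOf W p (by omega) hadd hI
  have h3 : ¬ 3 ∣ padicValInt p W.minimalDiscriminantInt := by rcases hv with h | h <;> omega
  have hG : TypeG W p := by
    refine (typeG_iff_padicValRat W p hp5).mpr ⟨hj, ?_⟩
    rw [padicValRat_Δ_eq W p]
    rcases hv with h' | h' <;> rw [h', h7] <;> norm_num
  exact typeGOrd_of_typeG_of_padicValRat_j W p hp5 (by subst h7; norm_num) hG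
    (j_eq_zero_or_padicValRat_j_pos_of_not_three_dvd W p hj h3)

/-- **At `5`, an additive fibre without `Iₙ*` of Kodaira type III (`ord₅ Δ_min = 3`, `e = 4 = p − 1`) is
(G)-ORDINARY**: `12 ∣ 4·3` gives (G); `2 ∤ 3` gives `j ≡ 1728 (mod 5)`, ordinary since `5 ≡ 1 (mod 4)`
(`typeGOrd_of_typeG_of_padicValRat_j_sub`). The Kosters–Pannekoek corner (5; III) (377 optimal `W[5]`-reducible
curves in range). [cite: DokchitserDokchitser2015LocalInvariants, Thm. 3.2]
[cite: SilvermanAEC2009, V.4.1(a) and Exercises V.4.4–4.5] -/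
theorem typeGOrd_five_of_padicValInt_eq_three (h5 : p = 5) (hadd : Addv W p)
    (hI : ∀ n : ℕ, W.kodairaSymbolAt (placeOf p) ≠ .Istar n)
    (hv : padicValInt p W.minimalDiscriminantInt = 3) : TypeGOrd W p := by
  have hp5 : 5 ≤ p := by omega
  have hj : 0 ≤ padicValRat p W.j := padicValRat_j_nonneg_of_forall_ne_Istar_placeOf W p (by omega) hadd hI
  have h2 : ¬ 2 ∣ padicValInt p W.minimalDiscriminantInt := by omega
  have hG : TypeG W p := by
    refine (typeG_iff_padicValRat W p hp5).mpr ⟨hj, ?_⟩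
    rw [padicValRat_Δ_eq W p, hv, h5]
    norm_num
  exact typeGOrd_of_typeG_of_padicValRat_j_sub W p hp5 (by subst h5; norm_num) hG
    (j_eq_or_padicValRat_j_sub_pos_of_not_two_dvd W p hp5 hj h2)

end Dictionary

/-! ## §2 The degree law from E-imc-9, uniformly in `p ≥ 5`, and DEGREE-UP(7; II) verbatim -/

/-- **E-imc-9 `OrdinaryRamifiedTwistLaw p` ⟹ the degree law on every potentially-ordinary unstarred optimal orbit**
(`p ≥ 5` prime, modularity): for `W` globally minimal with a lattice-optimal conductor-level datum `D`, `p² ∣ N(W)`,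
`W` potentially good ORDINARY at `p`, `ord_p Δ_min(W) < 6`, and every globally minimal `W′` with a lattice-optimal
conductor-level datum `D′`, `N(W′) = N(W)`, `W ⊗ p* ∼ W′`: `deg(D′) = p·deg(D)`. υ2's proof at `13`, verbatim in
`p`: the an-cell's PROVED trichotomy (`pStar_optimal_orbit_trichotomy_full`) — (i) done; (ii) `W′ = u • (W ⊗ p*)`:
clause 2 of E-imc-9; (iii) flip `deg′ = deg`: clause 1 makes a globally minimal `W₁ = C₀ • (W ⊗ p*)` optimal of
degree `p·deg`, `W₁ ∼ W′` have equal conductors (isogeny invariance granted modularity) and equal newform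
coefficients, hence the same period lattice, and the PROVED index engine at `s = 1` gives `deg(W₁) = deg(W′)`, so
`p·deg = deg` against `deg > 0`. Conditional result (open conjecture of the cell); closes nothing.
[cite: ZagierCMB1985, §1] [cite: DiamondShurman2005, §5.8 and Thm. 8.8.3] [cite: Watkins2002, §2.1] -/
theorem degreeUp_of_ordinaryRamifiedTwistLaw {p : ℕ} (hO : OrdinaryRamifiedTwistLaw p)
    (hnf : exists_isNewformOf) (hp : p.Prime) (h5 : 5 ≤ p)
    (W : WeierstrassCurve ℚ) [W.IsElliptic] [W.IsGloballyMinimal] [NeZero (W.conductorNorm ℤ)]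
    (D : ModularParametrizationData W (W.conductorNorm ℤ)) (hD : IsLatticeOptimal D)
    (hpN : p ^ 2 ∣ W.conductorNorm ℤ) (hpo : W.HasPotentiallyGoodOrdinaryReductionAtPrime p)
    (hv6 : padicValInt p W.minimalDiscriminantInt < 6)
    (W' : WeierstrassCurve ℚ) [W'.IsElliptic] [W'.IsGloballyMinimal] [NeZero (W'.conductorNorm ℤ)]
    (D' : ModularParametrizationData W' (W'.conductorNorm ℤ)) (hD' : IsLatticeOptimal D')
    (hNN : W'.conductorNorm ℤ = W.conductorNorm ℤ)
    (hiso : IsIsogenous (W.quadraticTwist (((-1 : ℤ) ^ (p / 2) * p : ℤ) : ℚ)) W') :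
    D'.modularDegree = p * D.modularDegree := by
  haveI hpF : Fact p.Prime := ⟨hp⟩
  have hp2 : p ≠ 2 := by omega
  rcases pStar_optimal_orbit_trichotomy_full hp hp2 W W' D D' hD hD' hpN hNN hiso with
    ⟨-, hdeg', -⟩ | ⟨⟨u, hu⟩, -, -⟩ | hdeg'
  · exact hdeg'
  · exact (hO W W' D u hp h5 hpN hpo hv6 hD hu).2 D' hD'
  · -- the flip is impossible under E-imc-9
    exfalso
    have hd0 : ((((-1 : ℤ) ^ (p / 2) * p : ℤ)) : ℚ) ≠ 0 := by
      push_cast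
      exact mul_ne_zero (pow_ne_zero _ (by norm_num)) (by exact_mod_cast hp.ne_zero)
    haveI : (W.quadraticTwist ((((-1 : ℤ) ^ (p / 2) * p : ℤ)) : ℚ)).IsElliptic := W.isElliptic_quadraticTwist hd0
    obtain ⟨C₀, hmin⟩ := hasGlobalMinimalModel_rat_holds (W.quadraticTwist ((((-1 : ℤ) ^ (p / 2) * p : ℤ)) : ℚ))
    haveI := hmin
    -- `W₁ := C₀ • (W ⊗ p*) ∼ W′`, so `N(W₁) = N(W′)` (granted modularity)
    have hiso1 : IsIsogenous (C₀ • W.quadraticTwist ((((-1 : ℤ) ^ (p / 2) * p : ℤ)) : ℚ)) W' :=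
      (isIsogenous_of_smul (W.quadraticTwist ((((-1 : ℤ) ^ (p / 2) * p : ℤ)) : ℚ)) C₀).trans' hiso
    have hN1 : (C₀ • W.quadraticTwist ((((-1 : ℤ) ^ (p / 2) * p : ℤ)) : ℚ)).conductorNorm ℤ =
        W'.conductorNorm ℤ :=
      conductorNorm_eq_of_isIsogenous_of_modularity
        (nonempty_modularParametrizationData_of_exists_isNewformOf hnf
          IsNewformOf.exists_maninConstant_ne_zero_holds) _ _ hiso1
    haveI : NeZero ((C₀ • W.quadraticTwist ((((-1 : ℤ) ^ (p / 2) * p : ℤ)) : ℚ)).conductorNorm ℤ) :=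
      ⟨by rw [hN1]; exact NeZero.ne _⟩
    -- E-imc-9: the twist model is optimal, with degree `p·deg`
    obtain ⟨⟨D₁, hD₁⟩, hall⟩ :=
      hO W (C₀ • W.quadraticTwist ((((-1 : ℤ) ^ (p / 2) * p : ℤ)) : ℚ)) D C₀ hp h5 hpN hpo hv6 hD rfl
    have hdeg₁ : D₁.modularDegree = p * D.modularDegree := hall D₁ hD₁
    -- the two optimal data of the class share the newform's period lattice
    have hcoefEq : ∀ n : ℕ, cuspCoeff D₁.f n = cuspCoeff D'.f n := fun n ↦ by
      rw [D₁.isNewformOf.2 n, D'.isNewformOf.2 n, hiso1.LFunction_eq]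
    have hΛ : periodLattice D₁.f = periodLattice D'.f :=
      periodLattice_eq_of_level_eq_of_cuspCoeff_eq hN1 D₁.f D'.f hcoefEq
    have h1 : ∀ w ∈ periodLattice D₁.f, (1 : ℂ) * w ∈ periodLattice D'.f := fun w hw ↦ by
      rw [one_mul, ← hΛ]; exact hw
    have h2 : ∀ w ∈ periodLattice D'.f, (1 : ℂ) * w ∈ periodLattice D₁.f := fun w hw ↦ by
      rw [one_mul, hΛ]; exact hw
    have hcoef : ∀ n : ℕ, ‖cuspCoeff D₁.f n‖ = ‖cuspCoeff D'.f n‖ := fun n ↦ by rw [hcoefEq]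
    have ha : ‖(1 : ℂ)‖ ^ 2 = ((1 : ℕ) : ℝ) := by simp
    have hc' : (D'.c : ℂ) ≠ 0 := by exact_mod_cast D'.maninConstant_ne_zero_holds
    have hc₁ : (D₁.c : ℂ) ≠ 0 := by exact_mod_cast D₁.maninConstant_ne_zero_holds
    have ht : (D'.c : ℂ) * 1 / (D₁.c : ℂ) ≠ 0 := div_ne_zero (by rw [mul_one]; exact hc') hc₁
    have ht' : (D₁.c : ℂ) * 1 / (D'.c : ℂ) ≠ 0 := div_ne_zero (by rw [mul_one]; exact hc₁) hc'
    obtain ⟨hmm, hmdeg⟩ := optimal_orbit_index_engine hN1 D' D₁ hD' hD₁ ha h1 h2 hcoef ht ht'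
    rw [one_pow] at hmm
    have hm1 := Nat.eq_one_of_mul_eq_one_right hmm
    rw [hm1, one_mul, one_mul] at hmdeg
    -- `deg(D₁) = deg(D′) = deg(D)` against `deg(D₁) = p·deg(D)`, `p ≥ 5`, `deg(D) > 0`
    have hpos : 0 < D.modularDegree := D.deg_pos
    have hkey : p * D.modularDegree = 1 * D.modularDegree := by rw [← hdeg₁, hmdeg, hdeg', one_mul]
    have h1 : p = 1 := Nat.eq_of_mul_eq_mul_right hpos hkey
    omega

/-- **DEGREE-UP(7; II) (hypothesis `hUp` of ν p624458 / p626637, VERBATIM) ⟸ E-imc-9 `OrdinaryRamifiedTwistLaw 7`.**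
The cell's potential good ORDINARY reduction at `7` is PROVED from `ord₇ Δ_min = 2` and «no `Iₙ*`» (§1); then §2.
The stub's twist-minimality, reducibility, `7 ∣ deg`, `N > 5·10⁵` binders are idle. Conditional result (open
conjecture of the cell); closes nothing. [cite: DokchitserDokchitser2015LocalInvariants, Thm. 3.2]
[cite: ZagierCMB1985, §1] [cite: Watkins2002, §2.1] -/
theorem degreeUpIISeven_of_ordinaryRamifiedTwistLaw (hO : OrdinaryRamifiedTwistLaw 7) :
    exists_isNewformOf →
    ∀ (W : WeierstrassCurve ℚ) [W.IsElliptic] [W.IsGloballyMinimal] [NeZero (W.conductorNorm ℤ)]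
      (D : ModularParametrizationData W (W.conductorNorm ℤ)),
      IsLatticeOptimal D → ∀ (p : ℕ) (hp : p.Prime), p = 7 → p ^ 2 ∣ W.conductorNorm ℤ →
      ¬ (∃ (W' : WeierstrassCurve ℚ) (q : ℕ), W'.IsElliptic ∧ W'.IsGloballyMinimal ∧ q.Prime ∧
          q ≠ 2 ∧ q ^ 2 ∣ W.conductorNorm ℤ ∧
          IsIsogenous W (W'.quadraticTwist (((-1 : ℤ) ^ (q / 2) * q : ℤ) : ℚ)) ∧
          ¬ q ^ 2 ∣ W'.conductorNorm ℤ) →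
      ¬ (∃ (W' : WeierstrassCurve ℚ) (d : ℤ), W'.IsElliptic ∧ W'.IsGloballyMinimal ∧
          (d = -1 ∨ d = 2 ∨ d = -2) ∧ 2 ^ 2 ∣ W.conductorNorm ℤ ∧
          IsIsogenous W (W'.quadraticTwist (d : ℚ)) ∧ ¬ 2 ^ 2 ∣ W'.conductorNorm ℤ) →
      ¬ W.HasIrreducibleModPGaloisRep p →
      500000 < W.conductorNorm ℤ →
      p ∣ D.modularDegree →
      (∀ n : ℕ, W.kodairaSymbolAt ((Rat.HeightOneSpectrum.primesEquiv (R := ℤ)).symm ⟨p, hp⟩) ≠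
        .Istar n) →
      padicValInt p W.minimalDiscriminantInt = 2 →
      ∀ (W' : WeierstrassCurve ℚ) [W'.IsElliptic] [W'.IsGloballyMinimal] [NeZero (W'.conductorNorm ℤ)]
        (D' : ModularParametrizationData W' (W'.conductorNorm ℤ)),
        IsLatticeOptimal D' → W'.conductorNorm ℤ = W.conductorNorm ℤ →
        IsIsogenous (W.quadraticTwist (((-1 : ℤ) ^ (p / 2) * p : ℤ) : ℚ)) W' →
        D'.modularDegree = p * D.modularDegree := by
  intro hnf W _ _ _ D hD p hp h7 hpN _hodd _hdy _hred _hN _hdeg hI hv2 W' _ _ _ D' hD' hNN hiso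
  haveI hpF : Fact p.Prime := ⟨hp⟩
  have hadd : Addv W p := not_good_and_not_mult_of_sq_dvd_conductorNorm W hpN
  have hpo : W.HasPotentiallyGoodOrdinaryReductionAtPrime p :=
    AdditiveBranchIMCGordTwoRankOne.hasPotentiallyGoodOrdinaryReductionAtPrime_of_typeGOrd
      (typeGOrd_seven_of_padicValInt_eq_two_or_four W p h7 hadd hI (Or.inl hv2))
  subst h7
  exact degreeUp_of_ordinaryRamifiedTwistLaw hO hnf hp (by norm_num) W D hD hpN hpo (by omega) W' D' hD' hNN hiso

/-- **The degree law on ALL THREE potentially-ordinary unstarred cells of the `W[p]`-reducible residue at `5, 7`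
— `(5; III)`, `(7; II)`, `(7; IV)` — ⟸ E-imc-9(5) ∧ E-imc-9(7)** (ordinarity PROVED cell by cell, §1; census:
377 + 112 + 43 commuting orbits in range, `v_p(deg′) = v_p(deg) + 1` on every one; the potentially supersingular cells
`(5; II), (5; IV), (7; III)` FLIP and are NOT covered — a degree-up law there is refuted in range, LEDGER gen 4 κ).
Conditional result; closes nothing. [cite: DokchitserDokchitser2015LocalInvariants, Thm. 3.2] [cite: Watkins2002, §2.1] -/
theorem degreeUp57Ord_of_ordinaryRamifiedTwistLaw (hO5 : OrdinaryRamifiedTwistLaw 5)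
    (hO7 : OrdinaryRamifiedTwistLaw 7) (hnf : exists_isNewformOf)
    (W : WeierstrassCurve ℚ) [W.IsElliptic] [W.IsGloballyMinimal] [NeZero (W.conductorNorm ℤ)]
    (D : ModularParametrizationData W (W.conductorNorm ℤ)) (hD : IsLatticeOptimal D)
    (p : ℕ) (hp : p.Prime) (hpN : p ^ 2 ∣ W.conductorNorm ℤ)
    (hI : ∀ n : ℕ, W.kodairaSymbolAt ((Rat.HeightOneSpectrum.primesEquiv (R := ℤ)).symm ⟨p, hp⟩) ≠ .Istar n)
    (hcell : (p = 5 ∧ padicValInt p W.minimalDiscriminantInt = 3) ∨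
      (p = 7 ∧ padicValInt p W.minimalDiscriminantInt = 2) ∨
      (p = 7 ∧ padicValInt p W.minimalDiscriminantInt = 4))
    (W' : WeierstrassCurve ℚ) [W'.IsElliptic] [W'.IsGloballyMinimal] [NeZero (W'.conductorNorm ℤ)]
    (D' : ModularParametrizationData W' (W'.conductorNorm ℤ)) (hD' : IsLatticeOptimal D')
    (hNN : W'.conductorNorm ℤ = W.conductorNorm ℤ)
    (hiso : IsIsogenous (W.quadraticTwist (((-1 : ℤ) ^ (p / 2) * p : ℤ) : ℚ)) W') :
    D'.modularDegree = p * D.modularDegree := by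
  haveI hpF : Fact p.Prime := ⟨hp⟩
  have hadd : Addv W p := not_good_and_not_mult_of_sq_dvd_conductorNorm W hpN
  rcases hcell with ⟨h5, hv⟩ | ⟨h7, hv⟩ | ⟨h7, hv⟩
  · have hpo := AdditiveBranchIMCGordTwoRankOne.hasPotentiallyGoodOrdinaryReductionAtPrime_of_typeGOrd
      (typeGOrd_five_of_padicValInt_eq_three W p h5 hadd hI hv)
    subst h5
    exact degreeUp_of_ordinaryRamifiedTwistLaw hO5 hnf hp (by norm_num) W D hD hpN hpo (by omega) W' D' hD' hNN hiso
  · have hpo := AdditiveBranchIMCGordTwoRankOne.hasPotentiallyGoodOrdinaryReductionAtPrime_of_typeGOrd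
      (typeGOrd_seven_of_padicValInt_eq_two_or_four W p h7 hadd hI (Or.inl hv))
    subst h7
    exact degreeUp_of_ordinaryRamifiedTwistLaw hO7 hnf hp (by norm_num) W D hD hpN hpo (by omega) W' D' hD' hNN hiso
  · have hpo := AdditiveBranchIMCGordTwoRankOne.hasPotentiallyGoodOrdinaryReductionAtPrime_of_typeGOrd
      (typeGOrd_seven_of_padicValInt_eq_two_or_four W p h7 hadd hI (Or.inr hv))
    subst h7
    exact degreeUp_of_ordinaryRamifiedTwistLaw hO7 hnf hp (by norm_num) W D hD hpN hpo (by omega) W' D' hD' hNN hiso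

end Summit.BirchSwinnertonDyer.BirchSwinnertonDyer.Theorems

end
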